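import Mathlib
import HarnessLib

/-!
# The Robert–Sargos fourth-derivative test for exponential sums (named fact)

Topic `Literature/NumberTheory/LFunctions`. The fourth-derivative test of Robert–Sargos
(*Compositio Math.* 130 (2002), Theorem 1): for `f ∈ C⁴[1, M]` with `λ₄ ≤ f⁽⁴⁾ ≪ λ₄` small,
`∑_{m ≤ M} e(f(m)) ≪_ε M^ε (M λ₄^{1/13} + λ₄^{-7/13})` — the classical van der Corput exponent
`1/14` improved to `1/13` "by reducing the problem to a mean square value theorem for triple
exponential sums". It is recorded here as a NAMED FACT in the normalisation in which it is
restated by Sargos, *Acta Arith.* 110 (2003), Lemma 4, p. 226 (the printed source read for this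
file), namely as **the case `u = 0` of that lemma**, which is exactly [RS] Theorem 1 (see
"Faithfulness notes" and "Scope of the recorded statement" below).

Why it is here: in the decomposition of Bourgain's bound `|ζ(1/2 + it)| ≪ |t|^{13/84 + ε}`
(`Literature.NumberTheory.LFunctions.bourgain_subconvexity`; files `ZetaSubconvexity.lean`,
`ZetaSubconvexityProofs.lean`, `ApproxFunctionalEquation.lean`) the test gives Bourgain's (3.19)
for `F = log` on the whole range `0 ≤ α = log M / log T ≤ 17/42` — exactly up to the lower end of
the range of Bourgain's Theorem 4 (`M (T/M⁴)^{1/13} ≤ M^{1/2} T^{13/84}` iff `α ≤ 17/42`) — and so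
replaces Huxley's estimate (4.1) (`Literature.NumberTheory.LFunctions.Bourgain2017_eq41_log`,
the Bombieri–Iwaniec–Huxley method) in §5 of Bourgain's paper: see the sibling file
`ZetaSubconvexityRobertSargos.lean` (`bourgain_subconvexity_of_theorem4_of_sargos`). This file
also provides the calculus of the model phase `g(x) = -T (log(x + c) - L)` used there
(`g⁽⁴⁾ = 6T/(x + c)⁴`).

## Content

* `Literature.NumberTheory.LFunctions.Sargos2003_lemma4` — NAMED FACT (Sargos 2003, Lemma 4 in the
  case `u = 0` = Robert–Sargos 2002, Thm 1, in Sargos's normalisation): for `g ∈ C⁴[1, M]` with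
  `λ₄ ≤ g⁽⁴⁾ ≪ λ₄` on `[1, M]`: `∑_{m=1}^{M} e(g(m)) ≪_ε M^ε (M λ₄^{1/13} + λ₄^{-7/13})`.
* `Literature.NumberTheory.LFunctions.robertSargos_fourthDerivTest` — the same statement in
  applied form (`∃ C` for given `C₀, ε`); kept under this name because the users
  (`ZetaSubconvexityRobertSargos.lean`) call it.
* `deriv_logPhase`, `iteratedDeriv_four_logPhase`, `contDiffAt_logPhase`,
  `logPhase_deriv_bounds` — PROVED: the model phase `g(x) = -T (log(x + (a-1)) - L)` is `C⁴` on
  `[1, K]` and `6T/b⁴ ≤ g⁽⁴⁾ ≤ 16 · 6T/b⁴` there when `b = K + a - 1 ≤ 2a`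
  (tools: `iterate_deriv_const_mul`, `iterate_deriv_comp_add_const`, Mathlib's
  `iter_deriv_inv_linear`); `norm_sum_exp_neg` (`‖∑ e(-θ_j)‖ = ‖∑ e(θ_j)‖`).

## Faithfulness notes

* Source read: Sargos 2003, p. 226, Lemma 4: "Let `g, u : [1, M] → ℝ` be respectively `C⁴` and
  `C²` with `λ₄ ≤ g⁽⁴⁾(x) ≪ λ₄` and `u''(x) ≪ λ₄^{9/13}` for `1 ≤ x ≤ M`. Then
  `∑_{m=1}^{M} e(g(m) + u(m)) ≪_ε M^ε (M λ₄^{1/13} + λ₄^{-7/13})`." Heath-Brown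
  (arXiv:1601.04493, §1) quotes [RS] as "if `k = 4` then
  `∑_{n ≤ N} e(f(n)) ≪_ε N^ε (N λ₄^{1/13} + λ₄^{-7/13})`", and the zbMATH review of [RS]
  (Zbl 1006.11045) as "Let `f : [1, M] → ℝ` be a function with four continuous derivatives that
  satisfies the van der Corput condition that `λ ≤ f⁽⁴⁾(x) ≪ λ` for `1 ≤ x ≤ M` …".
  (The store's copy of Robert–Sargos 2002 itself is unreadable; acquisition `acq-00800` is open.)
* Standing conventions of Sargos's paper (§1, p. 219; "Notations", p. 221) are made explicit
  hypotheses: `M` is an integer with `M ≥ 10` ("let `M` be a large integer (say, once for all,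
  `M ≥ 10`)"); `λ₄` is "a small positive number (say, once for all, `λ_k ≤ 1/10`)"; "`u ≪ v`"
  means `|u| ≤ C v` with an absolute constant `C` "which depends at most on previous absolute
  constants", and "`≪_ε`" allows dependence on `ε` as well. Accordingly the implied constant of
  the HYPOTHESIS is an arbitrary `C₀` fixed first, and the constant of the conclusion may depend
  on `C₀` and `ε` only (uniformly in `M`, `λ₄`, `g`):
  `∀ C₀, ∀ ε > 0, ∃ C, ∀ M ≥ 10, ∀ λ₄ ∈ (0, 1/10], ∀ g, … → ‖∑‖ ≤ C M^ε (M λ₄^{1/13} + λ₄^{-7/13})`.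
* `λ₄ ≤ g⁽⁴⁾(x) ≪ λ₄` is recorded sign-definite, `λ₄ ≤ g⁽⁴⁾(x) ≤ C₀ λ₄`, as printed in Lemma 4
  (the paper's general hypothesis (1) reads `λ_k ≤ |f^{(k)}(x)| ≪ λ_k`; a sum with `g⁽⁴⁾ < 0` is
  the complex conjugate of one with `g⁽⁴⁾ > 0`, cf. `norm_sum_exp_neg`). "`C⁴` on `[1, M]`" is
  `ContDiffOn ℝ 4 g (Set.Icc 1 M)` with the derivative `iteratedDerivWithin 4 g (Set.Icc 1 M)`
  (one-sided at the end-points); `e(z) = exp(2πiz)`.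

## Scope of the recorded statement (split review, 2026-08-15)

An earlier revision of this file recorded Lemma 4 with its `C²` perturbation `u`
(`|u''| ≤ C₀ λ₄^{9/13}`). That generality is used by no declaration of the tree — every user goes
through `robertSargos_fourthDerivTest`, i.e. `u = 0` — and it is proved in print only as a sketch
of modifications to another paper's proof: "In the proof of Theorem 1 of [6], set
`f(m) = g(m) + u(m)`. The first change occurs in step 1 of that proof … The main change occurs in
formula (4.16) of [6], where we have to remove the term `z = Δ_h u(m+n+q) - Δ_{h+r} u(m)` … we
write roughly `e(z₁) = 1 + O(|z₁|)`. The term `O(|z₁|)` yields the desired saving when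
`u''(x) ≪ λ₄^{9/13}`" (Sargos 2003, p. 226, the whole proof). The statement whose complete proof
is printed is the case `u = 0`, i.e. Robert–Sargos 2002, Theorem 1, and that is what the named
fact now records (a special case of the printed Lemma 4, never a stronger statement); its
discharge is to follow the printed proof of [RS], Thm 1 (Weyl–van der Corput differencing, the
`B`-process and a mean-square bound for triple exponential sums — cf. the tree's
`VanDerCorputBProcess.lean`, `ExplicitAProcess.lean`, `DoubleLargeSieve.lean`); the general form is
left as a `TODO(general form)` comment next to the definition.

## References

* P. Sargos, *An analog of van der Corput's `A⁴`-process for exponential sums*, Acta Arith. 110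
  (2003), 219–231, doi:10.4064/aa110-3-2 — §1 (conventions), Lemma 4 (p. 226).
* O. Robert, P. Sargos, *A fourth derivative test for exponential sums*, Compositio Math. 130
  (2002), 275–292, doi:10.1023/A:1014363224308 — Theorem 1.
* D. R. Heath-Brown, *A new k-th derivative estimate for exponential sums via Vinogradov's mean
  value*, arXiv:1601.04493, §1 (the quotation of [RS]).
* zbMATH review Zbl 1006.11045 of [RS] (the quotation of its hypotheses).
-/

noncomputable section

open Complex Finset
open scoped Real

namespace Literature.NumberTheory.LFunctions

/-! ## The named fact -/

/-- NAMED FACT — **Sargos 2003, Lemma 4, case `u = 0`** (= the fourth-derivative test of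
Robert–Sargos 2002, Thm 1, in Sargos's normalisation): "Let `g : [1, M] → ℝ` be `C⁴` with
`λ₄ ≤ g⁽⁴⁾(x) ≪ λ₄` for `1 ≤ x ≤ M`. Then `∑_{m=1}^{M} e(g(m)) ≪_ε M^ε (M λ₄^{1/13} + λ₄^{-7/13})`",
under the paper's standing conventions `M ≥ 10` an integer and `0 < λ₄ ≤ 1/10` (§1), the implied
constant of the hypothesis being an arbitrary `C₀` and that of the conclusion depending on `C₀, ε`
only. Recorded with `λ₄ ≤ g⁽⁴⁾ ≤ C₀ λ₄` (sign-definite, as printed) on `[1, M]`, the derivative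
taken within `[1, M]`. The printed Lemma 4 allows moreover a perturbation `u ∈ C²[1, M]` with
`|u''| ≪ λ₄^{9/13}` inside `e(·)`; that generality is not recorded (see the module docstring,
"Scope of the recorded statement"). Users take `(h : Sargos2003_lemma4)`.
[cite: Sargos2003, Lemma 4] [cite: RobertSargos2002, Theorem 1] -/
def Sargos2003_lemma4 : Prop :=
  ∀ C₀ : ℝ, ∀ ε : ℝ, 0 < ε → ∃ C : ℝ, ∀ M : ℕ, 10 ≤ M → ∀ lam : ℝ, 0 < lam → lam ≤ 1 / 10 →
    ∀ g : ℝ → ℝ, ContDiffOn ℝ 4 g (Set.Icc 1 M) →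
      (∀ x ∈ Set.Icc (1 : ℝ) M, lam ≤ iteratedDerivWithin 4 g (Set.Icc 1 M) x ∧
        iteratedDerivWithin 4 g (Set.Icc 1 M) x ≤ C₀ * lam) →
      ‖∑ m ∈ Finset.Icc 1 M, Complex.exp (2 * ↑π * I * ↑(g m))‖ ≤
        C * (M : ℝ) ^ ε * ((M : ℝ) * lam ^ (1 / 13 : ℝ) + lam ^ (-(7 / 13 : ℝ)))

-- TODO(general form): Sargos 2003, Lemma 4 with a perturbation `u ∈ C²[1, M]`,
-- `|u''| ≪ λ₄^{9/13}` on `[1, M]`: `∑_{m=1}^{M} e(g(m) + u(m)) ≪_ε M^ε (M λ₄^{1/13} + λ₄^{-7/13})`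
-- (proved in print only as a sketch of modifications to the proof of [RS], Thm 1, p. 226; no user
-- in the tree needs `u ≠ 0`).

/-- **The Robert–Sargos fourth-derivative test** (Robert–Sargos 2002, Thm 1, in Sargos's
normalisation), applied form of `Sargos2003_lemma4`: for `g ∈ C⁴[1, M]` with
`λ₄ ≤ g⁽⁴⁾ ≤ C₀ λ₄` on `[1, M]`, `M ≥ 10`, `0 < λ₄ ≤ 1/10`:
`‖∑_{m=1}^{M} e(g(m))‖ ≤ C M^ε (M λ₄^{1/13} + λ₄^{-7/13})`, `C = C(C₀, ε)`.
[cite: RobertSargos2002, Theorem 1] [cite: Sargos2003, Lemma 4] -/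
theorem robertSargos_fourthDerivTest (h : Sargos2003_lemma4) (C₀ : ℝ) {ε : ℝ} (hε : 0 < ε) :
    ∃ C : ℝ, ∀ M : ℕ, 10 ≤ M → ∀ lam : ℝ, 0 < lam → lam ≤ 1 / 10 →
      ∀ g : ℝ → ℝ, ContDiffOn ℝ 4 g (Set.Icc 1 M) →
        (∀ x ∈ Set.Icc (1 : ℝ) M, lam ≤ iteratedDerivWithin 4 g (Set.Icc 1 M) x ∧
          iteratedDerivWithin 4 g (Set.Icc 1 M) x ≤ C₀ * lam) →
        ‖∑ m ∈ Finset.Icc 1 M, Complex.exp (2 * ↑π * I * ↑(g m))‖ ≤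
          C * (M : ℝ) ^ ε * ((M : ℝ) * lam ^ (1 / 13 : ℝ) + lam ^ (-(7 / 13 : ℝ))) :=
  h C₀ ε hε

/-! ## Calculus of the model phase `g(x) = -T (log (x + c) - L)` -/

/-- `(d/dx)^n (a f) = a (d/dx)^n f` for Mathlib's total `deriv` (no differentiability needed).
[folklore] -/
theorem iterate_deriv_const_mul (a : ℝ) (f : ℝ → ℝ) :
    ∀ n : ℕ, deriv^[n] (fun x => a * f x) = fun x => a * (deriv^[n] f) x
  | 0 => rfl
  | n + 1 => by
    rw [Function.iterate_succ_apply', iterate_deriv_const_mul a f n, deriv_const_mul_field',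
      Function.iterate_succ_apply']

/-- `(d/dx)^n (f(x + c)) = f^{(n)}(x + c)` for Mathlib's total `deriv`. [folklore] -/
theorem iterate_deriv_comp_add_const (c : ℝ) (f : ℝ → ℝ) :
    ∀ n : ℕ, deriv^[n] (fun x => f (x + c)) = fun x => (deriv^[n] f) (x + c)
  | 0 => rfl
  | n + 1 => by
    rw [Function.iterate_succ_apply', iterate_deriv_comp_add_const c f n,
      Function.iterate_succ_apply']
    funext x
    exact deriv_comp_add_const _ _ _

/-- The model phase `g(x) = -T (log(x + c) - L)` has `g' = -T/(x + c)` (an identity of total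
functions, the junk values at `x = -c` agreeing). [folklore] -/
theorem deriv_logPhase (T c L : ℝ) :
    deriv (fun x => -T * (Real.log (x + c) - L)) = fun x => -T * (x + c)⁻¹ := by
  rw [deriv_const_mul_field']
  funext x
  rw [deriv_sub_const, deriv_comp_add_const, Real.deriv_log]

/-- **Fourth derivative of the model phase**: `g⁽⁴⁾(x) = 6T/(x + c)⁴` for
`g(x) = -T (log(x + c) - L)`. [folklore] -/
theorem iteratedDeriv_four_logPhase (T c L x : ℝ) :
    iteratedDeriv 4 (fun x => -T * (Real.log (x + c) - L)) x = 6 * T / (x + c) ^ 4 := by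
  rw [iteratedDeriv_eq_iterate]
  change deriv^[3] (deriv (fun x => -T * (Real.log (x + c) - L))) x = _
  rw [deriv_logPhase, iterate_deriv_const_mul,
    show (fun x : ℝ => (x + c)⁻¹) = fun x => (1 * x + c)⁻¹ by simp, iter_deriv_inv_linear]
  simp only [one_mul, one_pow, mul_one]
  rw [show (Nat.factorial 3 : ℝ) = 6 by norm_num [Nat.factorial]]
  rw [show (-1 - (3 : ℕ) : ℤ) = -4 by norm_num, zpow_neg, zpow_ofNat]
  ring

/-- The model phase is `C⁴` (indeed smooth) at every `x` with `x + c ≠ 0`. [folklore] -/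
theorem contDiffAt_logPhase (T c L : ℝ) {x : ℝ} (hx : x + c ≠ 0) :
    ContDiffAt ℝ 4 (fun x => -T * (Real.log (x + c) - L)) x := by
  have h1 : ContDiffAt ℝ 4 (fun x : ℝ => x + c) x := contDiffAt_id.add contDiffAt_const
  have h2 : ContDiffAt ℝ 4 Real.log (x + c) := Real.contDiffAt_log.2 hx
  have h3 : ContDiffAt ℝ 4 (fun x => Real.log (x + c)) x :=
    ContDiffAt.comp (g := Real.log) (f := fun y => y + c) x h2 h1
  exact contDiffAt_const.mul (h3.sub contDiffAt_const)

/-- **The hypotheses of the fourth-derivative test for the model phase**: for `T > 0`,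
`1 ≤ a`, `1 < K`, `b = K + a - 1 ≤ 2a`, the phase `g(x) = -T (log(x + (a-1)) - L)` is `C⁴` on
`[1, K]` and `6T/b⁴ ≤ g⁽⁴⁾(x) = 6T/(x + a - 1)⁴ ≤ 16 · 6T/b⁴` there. [folklore] -/
theorem logPhase_deriv_bounds {T a b K : ℝ} (hT : 0 < T) (ha : 1 ≤ a) (hK : 1 < K)
    (hKb : K + (a - 1) = b) (hb : b ≤ 2 * a) (L : ℝ) :
    ContDiffOn ℝ 4 (fun x => -T * (Real.log (x + (a - 1)) - L)) (Set.Icc 1 K) ∧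
    ∀ x ∈ Set.Icc (1 : ℝ) K,
      6 * T / b ^ 4 ≤ iteratedDerivWithin 4 (fun x => -T * (Real.log (x + (a - 1)) - L)) (Set.Icc 1 K) x ∧
      iteratedDerivWithin 4 (fun x => -T * (Real.log (x + (a - 1)) - L)) (Set.Icc 1 K) x ≤
        16 * (6 * T / b ^ 4) := by
  have hxc : ∀ x ∈ Set.Icc (1 : ℝ) K, a ≤ x + (a - 1) ∧ x + (a - 1) ≤ b := by
    intro x hx
    constructor
    · linarith [hx.1]
    · linarith [hx.2]
  have hb0 : 0 < b := by linarith
  refine ⟨fun x hx => ?_, fun x hx => ?_⟩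
  · have hx0 : x + (a - 1) ≠ 0 := by have := (hxc x hx).1; linarith
    exact (contDiffAt_logPhase T (a - 1) L hx0).contDiffWithinAt
  · obtain ⟨hxa, hxb⟩ := hxc x hx
    have hx0 : 0 < x + (a - 1) := by linarith
    rw [iteratedDerivWithin_eq_iteratedDeriv (uniqueDiffOn_Icc hK)
      (contDiffAt_logPhase T (a - 1) L hx0.ne') hx, iteratedDeriv_four_logPhase]
    constructor
    · -- `6T/b⁴ ≤ 6T/(x + a - 1)⁴` since `x + a - 1 ≤ b`
      apply div_le_div_of_nonneg_left (by positivity) (by positivity)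
      exact pow_le_pow_left₀ hx0.le hxb 4
    · -- `6T/(x + a - 1)⁴ ≤ 96 T/b⁴` since `b ≤ 2a ≤ 2(x + a - 1)`
      have h2 : b ≤ 2 * (x + (a - 1)) := by linarith
      have h2' : b ^ 4 ≤ (2 * (x + (a - 1))) ^ 4 := pow_le_pow_left₀ hb0.le h2 4
      rw [div_le_iff₀ (by positivity),
        show 16 * (6 * T / b ^ 4) * (x + (a - 1)) ^ 4 = 6 * T * ((2 * (x + (a - 1))) ^ 4 / b ^ 4) by
          ring]
      have h1 : 1 ≤ (2 * (x + (a - 1))) ^ 4 / b ^ 4 := by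
        rw [le_div_iff₀ (by positivity)]; linarith
      have h6 : 0 ≤ 6 * T := by positivity
      calc 6 * T = 6 * T * 1 := (mul_one _).symm
        _ ≤ 6 * T * ((2 * (x + (a - 1))) ^ 4 / b ^ 4) := mul_le_mul_of_nonneg_left h1 h6

/-- Complex conjugation: `‖∑ e(-θ_j)‖ = ‖∑ e(θ_j)‖`. [folklore] -/
theorem norm_sum_exp_neg (s : Finset ℕ) (θ : ℕ → ℝ) :
    ‖∑ j ∈ s, Complex.exp (2 * ↑π * I * ↑(-θ j))‖ =
      ‖∑ j ∈ s, Complex.exp (2 * ↑π * I * ↑(θ j))‖ := by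
  rw [← Complex.norm_conj (∑ j ∈ s, Complex.exp (2 * ↑π * I * ↑(θ j))), map_sum]
  congr 1
  refine Finset.sum_congr rfl fun j _ => ?_
  rw [← Complex.exp_conj]
  congr 1
  simp only [map_mul, Complex.conj_ofReal, Complex.conj_I, map_ofNat]
  push_cast
  ring

end Literature.NumberTheory.LFunctions
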